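import Mathlib
import HarnessLib
import Summits.NavierStokesRegularity.NavierStokesRegularity.Theorems.TaylorModelRungThreeCertificateFormatVGrowthCRun
import Summits.NavierStokesRegularity.NavierStokesRegularity.Theorems.TaylorModelRungThreeCertificateFormatVGrowthPairs

/-!
# Crux K1b-DR (stmt-NavierStokesRegularity-23954), line `taylor-model` — v3 growth checker VARIANT C, SOUNDNESS part 2:
# composed chains as ONE matrix product, the transfer chain `RS`, and (R3) (tm-g4 g5)

* `CertTables.matOfKer_kerOf_kiter_add` — **the coordinate matrix of a composed chain is the product of the coordinate
  matrices** (`kiter A s₀ (n+m) = kiter A (s₀+n) m ∘ kiter A s₀ n` on the window); `memMat_kiter_comp` — hence interval products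
  of enclosures enclose the composed chain (sign cancellation ACROSS the two pieces retained).
* `memMat_gTI` — the verified claim `prodM (qL) L ⊆ T_q` makes `T_q` an enclosure of every admissible chain over chunk `q`;
  **`memMat_RS`** — `RS j q m = T_{q−1}⋯T_{q−m}` encloses every admissible chain over the `m` chunks before chunk `q`.
* `facts_atC`, `L1_boundsC`, **`pair_testedC`** (every pair `(a', b)` was tested with the factor `gDC a' b`), `gDC_nonneg`,
  **`hR3a_of_growthC`**, **`hR3b_of_growthC`** — verbatim along v1 (`…FormatVGrowthPairs`) with `W = wVecC`.
MODEL-lattice bookkeeping only (rung TL-M3); nothing here is a statement about the Navier–Stokes equations.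
-/

-- the sub-problem namespace repeats the summit name by design (D-0017)
set_option linter.dupNamespace false

namespace Summit.NavierStokesRegularity.NavierStokesRegularity.Theorems.TaylorModelCert

open scoped BigOperators
open Literature.Analysis.FluidPDE.TaoCascade Literature.Analysis.FluidPDE.TaoCascade.TaylorChain
open Summit.NavierStokesRegularity.NavierStokesRegularity.Theorems.TaylorModelReadout
open Summit.NavierStokesRegularity.NavierStokesRegularity.Theorems.TaylorModelV

/-! ### Composed chains: the coordinate matrix is the matrix product -/

namespace CertTables

variable {K : Type} (T : CertTables K) {cd : CertData} (hKb : cd.Kb = T.Kb) (hKa : cd.Ka = T.Ka)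
include hKb hKa

/-- **Matrix of a composed chain** (coordinates `r < n`, any `c`):
`mat (kerOf (kiter A s₀ (n+m))) r c = Σ_{t<n} mat (kerOf (kiter A (s₀+n) m)) r t · mat (kerOf (kiter A s₀ n)) t c`. [folklore] -/
theorem matOfKer_kerOf_kiter_add (A : ℕ → Ker) (s₀ n m : ℕ) {r : ℕ} (hr : r < T.n) (c : ℕ) :
    T.matOfKer (kerOf (kiter cd A s₀ (n + m))) r c =
      ∑ t ∈ Finset.range T.n, T.matOfKer (kerOf (kiter cd A (s₀ + n) m)) r t * T.matOfKer (kerOf (kiter cd A s₀ n)) t c := by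
  have hkr := T.InW_wk hr
  simp only [CertTables.matOfKer]
  show kiter cd A s₀ (n + m) (basisSt (T.wi c) (T.wk c)) (T.wi r) (T.wk r) = _
  rw [kiter_add A s₀ n m (basisSt (T.wi c) (T.wk c)),
    kiter_eq_kapp_kerOf A (s₀ + n) m _ (T.wi r) (by rw [hKb]; exact hkr.1) (by rw [hKa]; exact hkr.2),
    kapp_apply_of_InW _ _ (T.wi r) (by rw [hKb, hKa]; exact hkr)]
  simp only [toVec]
  rw [T.sum_nW_eq_sum_range cd hKb hKa
    (fun i k => kerOf (kiter cd A (s₀ + n) m) (T.wi r) (T.wk r) i k * kiter cd A s₀ n (basisSt (T.wi c) (T.wk c)) i k)]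
  rfl

/-- **Enclosures compose**: if the coordinate matrix of every chain piece over `[s₀, s₀+n)` lies in `P` and that over
`[s₀+n, s₀+n+m)` lies in `Q`, the matrix of the composed chain over `[s₀, s₀+n+m)` lies in `mulII Q P`. [folklore] -/
theorem memMat_kiter_comp (prec : ℕ) {A : ℕ → Ker} {s₀ n m : ℕ} {P Q : Array (Array IntervalD)}
    (hP : MemMat T.n (T.matOfKer (kerOf (kiter cd A s₀ n))) P)
    (hQ : MemMat T.n (T.matOfKer (kerOf (kiter cd A (s₀ + n) m))) Q) :
    MemMat T.n (T.matOfKer (kerOf (kiter cd A s₀ (n + m)))) (mulII T.n prec Q P) := by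
  intro r hr c hc
  rw [T.matOfKer_kerOf_kiter_add hKb hKa A s₀ n m hr c]
  exact memMat_mulII prec hQ hP r hr c hc

end CertTables

namespace CertTablesV

variable {TV : CertTablesV} {kitOf : ℕ → CoreKit} {wT : ℕ → Array Dyad} {sc : ScalarsV}

section Stage

variable {P : ℕ → CoreOut → Bool} {j L : ℕ} (hL : 0 < L)
  (hGR : ∀ q, q * L < TV.S j → TV.growthRangeC kitOf wT P j L q = true)
include hL hGR

/-! ### The emitted transfer matrices enclose the chains -/

/-- **`T_q` encloses every admissible chain over chunk `q`** (when a later chunk exists, `(q+1)L < S`). [folklore] -/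
theorem memMat_gTI {q : ℕ} (hlater : (q + 1) * L < TV.S j) {Ac : ℕ → Ker}
    (hA : ∀ s', q * L ≤ s' → s' < q * L + L →
      KerMem (TV.toCertDataVW kitOf wT sc) (Ac s') ((TV.toBoxesW kitOf wT).Mlo j s') ((TV.toBoxesW kitOf wT).Mhi j s')) :
    MemMat TV.base.n (TV.base.matOfKer (kerOf (kiter (TV.toCertDataVW kitOf wT sc) Ac (q * L) L))) (TV.gTI j q) := by
  have hq : q * L < TV.S j := by nlinarith
  have hcl := (claimsC_sound (TV := TV) (kitOf := kitOf) (wT := wT) (hGR q hq) hL hlater).1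
  exact memMat_of_subsetIM hcl (memMat_prodM (sc := sc) L hA)

/-- **`RS j q m` encloses every admissible chain over the `m` chunks `q−m, …, q−1` before chunk `q`** (`m ≤ q`, `qL < S`).
[folklore] -/
theorem memMat_RS {q : ℕ} (hq : q * L < TV.S j) (Ac : ℕ → Ker) :
    ∀ m : ℕ, m ≤ q →
      (∀ s', (q - m) * L ≤ s' → s' < q * L →
        KerMem (TV.toCertDataVW kitOf wT sc) (Ac s') ((TV.toBoxesW kitOf wT).Mlo j s') ((TV.toBoxesW kitOf wT).Mhi j s')) →
      MemMat TV.base.n (TV.base.matOfKer (kerOf (kiter (TV.toCertDataVW kitOf wT sc) Ac ((q - m) * L) (m * L))))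
        (TV.RS j q m)
  | 0, _, _ => by
    intro r hr c hc
    rw [Nat.zero_mul, matOfKer_kerOf_kiter_zero (sc := sc) Ac _ hr hc]
    exact memMat_idIM TV.base.n r hr c hc
  | m + 1, hm, hA => by
    -- chunk `c := q − (m+1)` first, then the `m` chunks after it
    set c := q - (m + 1) with hc
    have hqm : q - m = c + 1 := by omega
    have ih := memMat_RS hq Ac m (by omega) (fun s' h1 h2 => hA s' (by rw [hqm] at h1; nlinarith) h2)
    rw [hqm] at ih
    have hlater : (c + 1) * L < TV.S j := lt_of_le_of_lt (Nat.mul_le_mul_right L (by omega)) hq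
    have hcq : (c + 1) * L ≤ q * L := Nat.mul_le_mul_right L (by omega)
    have hT := memMat_gTI (sc := sc) hL hGR hlater (Ac := Ac) (fun s' h1 h2 => hA s' h1 (by nlinarith))
    have e1 : (m + 1) * L = L + m * L := by ring
    have e2 : (c + 1) * L = c * L + L := by ring
    rw [e1]
    show MemMat TV.base.n _ (mulII TV.base.n TV.prec (TV.RS j q m) (TV.gTI j (q - 1 - m)))
    have e3 : q - 1 - m = c := by omega
    rw [e3]
    rw [e2] at ih
    exact TV.base.memMat_kiter_comp cd_Kb cd_Ka TV.prec hT ih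

/-! ### From the chunk Booleans to (R3) -/

/-- The run facts AT sub-step `t < S` (chunk `t/L`). [folklore] -/
theorem facts_atC {t : ℕ} (ht : t < TV.S j) :
    ((TV.ctxOfW kitOf wT j).subStep t ((TV.ctxOfW kitOf wT j).nodeAt t)).ok = true ∧
    P t ((TV.ctxOfW kitOf wT j).subStep t ((TV.ctxOfW kitOf wT j).nodeAt t)).core = true ∧
    (Dyad.ble Dyad.zero (TV.coreVW kitOf wT j t).L1 = true ∧ Dyad.ble (TV.coreVW kitOf wT j t).L1 (dget (TV.gL1 j) t) = true) ∧
    (∀ i', i' < t + 1 - t / L * L → (TV.gctx j L (t / L)).pairTest (t / L * L + i') (t + 1)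
      ((TV.gctx j L (t / L)).facOf (TV.prodM kitOf wT j (t / L * L + i') (t + 1 - (t / L * L + i'))) (TV.ωhiV j)) = true) ∧
    (TV.gctx j L (t / L)).pairTest (t + 1) (t + 1) ((TV.gctx j L (t / L)).facOf (idIM TV.base.n) (TV.ωhiV j)) = true ∧
    (∀ a' < t / L * L, (TV.gctx j L (t / L)).pairTest a' (t + 1)
      ((TV.gctx j L (t / L)).facOf (TV.prodM kitOf wT j (t / L * L) (t + 1 - t / L * L))
        ((TV.gctxC j L (t / L)).W.getD a' #[])) = true) := by
  have h1 : t / L * L ≤ t := Nat.div_mul_le_self t L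
  have h2 : t < t / L * L + L := Nat.lt_div_mul_add hL
  have hq : t / L * L < TV.S j := lt_of_le_of_lt h1 ht
  have hi : t - t / L * L < min L (TV.S j - t / L * L) := by
    apply lt_min <;> omega
  have h := (growthRangeC_sound (TV := TV) (kitOf := kitOf) (wT := wT) (hGR (t / L) hq)).1 (t - t / L * L) hi
  have e : t / L * L + (t - t / L * L) = t := by omega
  rw [e] at h
  exact h

omit hL hGR in
/-- `0 ≤ L1_t ≤ gL1[t]` as reals, for `t < S`, from the variant-C chunk Booleans. [folklore] -/
theorem L1_boundsC (hL : 0 < L) (hGR : ∀ q, q * L < TV.S j → TV.growthRangeC kitOf wT P j L q = true)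
    {t : ℕ} (ht : t < TV.S j) :
    0 ≤ ((TV.coreVW kitOf wT j t).L1).toReal ∧ ((TV.coreVW kitOf wT j t).L1).toReal ≤ (dget (TV.gL1 j) t).toReal := by
  obtain ⟨-, -, ⟨h0, h1⟩, -⟩ := facts_atC (TV := TV) (kitOf := kitOf) (wT := wT) hL hGR ht
  have h0' := (Dyad.ble_iff _ _).1 h0
  rw [Dyad.toReal_zero] at h0'
  exact ⟨h0', (Dyad.ble_iff _ _).1 h1⟩

/-- **Every pair `(a', b)`, `a' ≤ b`, `1 ≤ b ≤ S`, was tested with the factor `gDC a' b`.** [folklore] -/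
theorem pair_testedC {a' b : ℕ} (hb1 : 1 ≤ b) (hbS : b ≤ TV.S j) (hab : a' ≤ b) :
    (TV.gctx j L ((b - 1) / L)).pairTest a' b (TV.gDC kitOf wT j L a' b) = true := by
  have ht : b - 1 < TV.S j := by omega
  obtain ⟨-, -, -, hIn, hDiag, hOut⟩ := facts_atC (TV := TV) (kitOf := kitOf) (wT := wT) hL hGR ht
  set qb := (b - 1) / L with hqb
  have h1 : qb * L ≤ b - 1 := Nat.div_mul_le_self _ L
  have h2 : b - 1 < qb * L + L := Nat.lt_div_mul_add hL
  have eb : b - 1 + 1 = b := by omega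
  rw [eb] at hIn hDiag hOut
  rcases Nat.lt_or_ge a' (qb * L) with hlt | hge
  · -- earlier start: split factor with `wVecC`
    have hdiv : a' / L < qb := (Nat.div_lt_iff_lt_mul hL).2 hlt
    have hW : (TV.gctxC j L qb).W.getD a' #[] = TV.wVecC j L qb a' := W_gctxC (TV := TV) hlt
    have h := hOut a' hlt
    rw [hW] at h
    have hnot : ¬ b ≤ (a' / L + 1) * L := by
      have : (a' / L + 1) * L ≤ qb * L := Nat.mul_le_mul_right L hdiv
      omega
    unfold gDC
    rw [if_neg hnot]
    exact h
  · rcases Nat.lt_or_ge a' b with hltb | hgeb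
    · -- start inside the chunk: direct factor
      have hi' : a' - qb * L < b - qb * L := by omega
      have h := hIn (a' - qb * L) hi'
      have e1 : qb * L + (a' - qb * L) = a' := by omega
      rw [e1] at h
      have hdiv : a' / L = qb := div_eq_of_chunk hL hge (by omega)
      have hpos : b ≤ (a' / L + 1) * L := by rw [hdiv]; linarith
      unfold gDC
      rw [if_pos hpos, hdiv, facOf_gctx j L qb qb]
      exact h
    · -- `a' = b`: identity factor
      have hab' : a' = b := le_antisymm hab hgeb
      subst hab'
      have hpos : a' ≤ (a' / L + 1) * L := by
        have := Nat.lt_div_mul_add (a := a') hL; linarith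
      unfold gDC
      rw [if_pos hpos, Nat.sub_self, facOf_gctx j L (a' / L) qb]
      exact hDiag

omit hL hGR in
/-- `0 ≤ gDC`. [folklore] -/
theorem gDC_nonneg (a b : ℕ) : 0 ≤ (TV.gDC kitOf wT j L a b).toReal := by
  unfold gDC; split_ifs <;> exact GCtx.facOf_nonneg _ _ _

/-- **(R3a) from the variant-C growth Booleans.** [folklore] -/
theorem hR3a_of_growthC (a b : ℕ) (ha : a < TV.S j) (hab : a + 1 ≤ b) (hb : b ≤ TV.S j) :
    (TV.toCertDataVW kitOf wT sc).L1 j a * TV.GrC kitOf wT j L (a + 1) b ≤ TV.ΛTr j ∧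
    (b < TV.S j → (TV.toCertDataVW kitOf wT sc).L1 j a * TV.GrC kitOf wT j L (a + 1) b *
      (TV.toCertDataVW kitOf wT sc).L1 j b ≤ (TV.toCertDataVW kitOf wT sc).Λ j) := by
  have hpt := pair_testedC (TV := TV) (kitOf := kitOf) (wT := wT) hL hGR (a' := a + 1) (b := b) (by omega) hb hab
  have hgb : b < TV.S j → 0 ≤ (dget (TV.gL1 j) b).toReal := fun hb' =>
    (L1_boundsC (TV := TV) (kitOf := kitOf) (wT := wT) hL hGR hb').1.trans (L1_boundsC hL hGR hb').2
  obtain ⟨h1, h2⟩ := pairTest_sound (TV := TV) hpt (by omega) hgb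
  simp only [Nat.add_sub_cancel] at h1 h2
  obtain ⟨hL1a0, hL1a⟩ := L1_boundsC (TV := TV) (kitOf := kitOf) (wT := wT) hL hGR ha
  have hG0 := gDC_nonneg (TV := TV) (kitOf := kitOf) (wT := wT) (j := j) (L := L) (a + 1) b
  have hΛdes : ((IntervalD.ofQS2 TV.prec (TV.stageV j).Λdes).lo).toReal ≤ TV.ΛTr j := (IntervalD.mem_ofQS2 TV.prec _).1
  have hΛ : ((IntervalD.ofQS2 TV.prec (TV.base.stage j).Λ).lo).toReal ≤ (TV.toCertDataVW kitOf wT sc).Λ j :=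
    (IntervalD.mem_ofQS2 TV.prec _).1
  rw [cd_L1]
  unfold GrC
  constructor
  · calc ((TV.coreVW kitOf wT j a).L1).toReal * (TV.gDC kitOf wT j L (a + 1) b).toReal
        ≤ (dget (TV.gL1 j) a).toReal * (TV.gDC kitOf wT j L (a + 1) b).toReal := mul_le_mul_of_nonneg_right hL1a hG0
      _ ≤ _ := h1.trans hΛdes
  · intro hb'
    obtain ⟨hL1b0, hL1b⟩ := L1_boundsC (TV := TV) (kitOf := kitOf) (wT := wT) hL hGR hb'
    rw [cd_L1]
    calc ((TV.coreVW kitOf wT j a).L1).toReal * (TV.gDC kitOf wT j L (a + 1) b).toReal * ((TV.coreVW kitOf wT j b).L1).toReal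
        ≤ (dget (TV.gL1 j) a).toReal * (TV.gDC kitOf wT j L (a + 1) b).toReal * (dget (TV.gL1 j) b).toReal :=
          mul_le_mul (mul_le_mul_of_nonneg_right hL1a hG0) hL1b hL1b0 (mul_nonneg (hL1a0.trans hL1a) hG0)
      _ ≤ _ := (h2 hb').trans hΛ

omit hL hGR in
/-- **(R3b) from `checkL1` and the variant-C growth Booleans.** [folklore] -/
theorem hR3b_of_growthC (hL : 0 < L) (hGR : ∀ q, q * L < TV.S j → TV.growthRangeC kitOf wT P j L q = true)
    (hcL : TV.checkL1 j = true) (a : ℕ) (ha : a < TV.S j) :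
    (TV.toCertDataVW kitOf wT sc).L1 j a ≤ (TV.toCertDataVW kitOf wT sc).Λ j := by
  unfold checkL1 at hcL
  simp only [Bool.and_eq_true, allN_eq_true, decide_eq_true_eq] at hcL
  have h := (Dyad.ble_iff _ _).1 (hcL.2 a ha)
  have hΛ : ((IntervalD.ofQS2 TV.prec (TV.base.stage j).Λ).lo).toReal ≤ (TV.toCertDataVW kitOf wT sc).Λ j :=
    (IntervalD.mem_ofQS2 TV.prec _).1
  rw [cd_L1]
  exact ((L1_boundsC (TV := TV) (kitOf := kitOf) (wT := wT) hL hGR ha).2.trans h).trans hΛ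

end Stage

end CertTablesV

end Summit.NavierStokesRegularity.NavierStokesRegularity.Theorems.TaylorModelCert
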